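import Summits.QuantumFields.YangMills.Theorems.UnitScaleTiltProp7SPrintThm2Dict
import Summits.QuantumFields.YangMills.Theorems.UnitScaleTiltProp7ChartSigmaT3GlevSU
import Literature.MathematicalPhysics.QuantumFieldTheory.Balaban1983to89.B8Eq106Local
import Literature.MathematicalPhysics.QuantumFieldTheory.Balaban1983to89.B7Prop3to7Local
import Literature.MathematicalPhysics.QuantumFieldTheory.Balaban1983to89.B8Prop7TowerAxialZd3
import HarnessLib

/-!
# Route `UnitScaleTilt`, crux K1 «MinimiserStabilityRegPr» (stmt-QuantumFields-19200), route-R E′ path (α′), (E1) Thm-2 datum socket — (P2 of LOCATE «HDATUM-OF-THM2S»):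
# **[Balaban1985RegularSpaces] (1.72) AT THE k-CENTRES OF THE T³ CARRIER** — the gauge transformation `u` of Prop. 2 ∕ Thm 2 (based-(1.29)-restricted, bringing `U₁U₀` to the
# based axial gauge (1.19)) is `O(ε₂)`-close to `1` at every k-centre: `dist1 (u (embIter (K−n) y)) ≤ 40·3·c` whenever `U₁ = e^{iX}` with `‖X‖ ≤ c·η`, under print's numeric windows

Cell `ym3-torus`, width seat `ym3-torus-px13` (gen 4); LOCATE «HDATUM-OF-THM2S» (19200 evidence n = 40, 2026-08-29) piece (P2) — the one row of the (E1)-door's Thm-2 datum socket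
(✓ `Prop7PinnedSliceRowOfThm2Datum.pinnedSliceRow_of_thm2Datum`'s `hσ : dist1 (u c_y) ≤ σ`) that COV (✓ `Prop7CovOfThm2.cov_of_thm2SetupSUAt`) does not export.  THEOREMS ONLY
(0 `def`, 0 `sorry`, 0 `instance`); `--supports stmt-QuantumFields-19200`, count-neutral.  YM₃ on T³ is a ladder rung (R3), not the Clay problem; nothing here claims the stub, the crux,
d = 4 or the gap.

WHY ∕ HOW.  Print derives (1.70)–(1.72) («|u(x) − 1| < 16dB₁(α₀ + α₁)», p. 88) from (104)–(106) of [Balaban1985Averaging]: `u` is determined by the axial conditions in the tower under each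
top-level site and the restriction (1.29) there.  The tree holds this on the `ℤᵈ` carriers with LOCAL hypotheses: lit ✓ `B8Eq106Local.ineq172_local_of_axial` (`hax` = (1.19) in the tower,
`h129` = (1.29) at `y`, `h33` = (1.33) on the block, `h69` = `|B_b| ≤ c·L^{−j}`, print's windows ⟹ `‖u(x) − 1‖ ≤ 40·d·c` on `Bʲ(y)`).  THIS FILE reads it at the top level `j = k = K − n` on the
pullbacks BASED AT `x₀ = basePt F n K` — the letters of ✓ `Prop7SPrint.IsAxialPrint` ∕ `RestrictedPrint` (the EX lineage's, in which COV concludes): `hax ⟸ IsAxialPrint W (gaugeAct u (emb15 W U₁))`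
(with `(U₁U₀)^u ♯ = mgauge Wp up U₁♯ · Wp`, lit `eq117_eq_mgauge`, ✓ `pull_toUField_gaugeAct`, ✓ `mulCfg_pull`), `h129 ⟸ RestrictedPrint W u` (lit `restr129_iff_uavg`), `h33 ⟸ RegPr e W`
(✓ `inAk_pull_of_regPr`, ✓ `pdev_pull_lt`, lit `pdevOn_le_pdev`), `h69 ⟸ ‖X b‖ ≤ c·η` (`U₁♯ = expCfg (i·X♯)`); the k-centre `embIter k y` is the corner `Lᵏyz` of the block under `yz`
(✓ `Prop7AxialReprPrint.embIter_eq_transl`, lit `under_smul_self`), and `dist1 g = ‖g − 1‖` on `SU(2)`.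

WHAT IS PROVED (ns `…Theorems.Prop7Thm2GaugeCentreValues`).
* `pull_gaugeAct_emb15_eq` — `(gaugeAct u (emb15 W U₁))♯ = mgauge Wp up U₁♯ * Wp` (based pullbacks at any `x₀`).
(`U₁♯ = expCfg (i·X♯)` is ✓ `Prop7ChartSigmaT3GlevSU.pull_eq_expCfg_of_exp`, reused by name.)
* ★★ `dist1_centre_le_of_axial_restricted` — the statement of the title.
HONEST SCOPE.  Letter bookkeeping over lit ✓ `B8Eq106Local.ineq172_local_of_axial`; the windows are print's ([Balaban1985Averaging] Prop. 2: `C₀·2e ≤ ⅓`, `8e ≤ c₂′`;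
[Balaban1985RegularSpaces] p. 88: `hsmall`, `2c ≤ c₃`, `384c ≤ 1`), displayed, L-only.  Constant `120c` (print `16d·B₁(α₀+α₁)`).

References: T. Bałaban, CMP 99 (1985) 75–102 [Balaban1985RegularSpaces] ((1.70)–(1.72) p.88, (1.19) p.79, (1.29) p.81, (1.33) p.82); CMP 98 (1985) 17–51 [Balaban1985Averaging]
((55) p.27, (78)–(81) p.30, (104)–(106) p.33, Prop. 2 p.26); CMP 102 (1985) 277–309 [Balaban1985Variational] (Prop. 2 p.281, (15)–(19) pp.280–281).
-/

set_option autoImplicit false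

noncomputable section

open scoped Matrix.Norms.L2Operator Matrix
open NormedSpace

namespace Summit.QuantumFields.YangMills.Theorems.Prop7Thm2GaugeCentreValues

open Literature.MathematicalPhysics.QuantumFieldTheory.Balaban1983to89
open Literature.MathematicalPhysics.QuantumFieldTheory.Balaban1983to89.T3ContinuumYM3Torus
open Literature.MathematicalPhysics.QuantumFieldTheory.Balaban1983to89.T3PrintedRegularMinimiser (RegPr)
open B7Prop1Explicit renaming Site → LSite
open B7Prop1Explicit (e expUnit val_expUnit)
open B7Prop2Explicit (pdev C0 c2' C0_pos c2'_pos AvgClosed unitaryUnits_le_U1)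
open B7Prop2SpecialUnitary (specialUnitaryUnits specialUnitaryUnits_le_unitaryUnits)
open B7AvgClosedSpecialUnitarySharp (avgClosed_specialUnitary_of_le_twentyone)
open B7Prop3Flat (expCfg c3)
open B7Prop1Local (pdevOn)
open B7Prop3to7Local (pdevOn_le_pdev)
open B7Eq92Concrete (mgauge)
open B8Lemma1NonAbelian (mulCfg)
open B8Ineq130 (tlo thi)
open B8Ineq132 (Under InAk)
open B8Eq119TwistedAxial (InAx Restr129)
open B8Eq131Derivation (eq117_eq_mgauge ax119_iff_ax67)
open B8Eq178Averages (restr129_iff_uavg)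
open B8Eq106Local (ineq172_local_of_axial)
open B8Prop7TowerAxialZd3 (under_smul_self)
open B8Thm4TorusAt (torusLam mem_torusLam_iff)
open B8Thm2SetupTorus (toUGauge toUGauge_apply pullGauge pullGauge_apply unitsField_toUField_mem)
open B10Eq27TorusAxialLog (transl pull pull_apply unitsField toUField val_unitsField val_suIncl suIncl)
open B15DeterminingSets (embIter)
open T3SectALandauChart (emb15 eta eta_pos)
open Summit.QuantumFields.YangMills.Theorems.Prop7SPrint (basePt IsAxialPrint RestrictedPrint)
open Summit.QuantumFields.YangMills.Theorems.Prop7AxialReprPrint (pull_toUField_gaugeAct pull_toUField_mem pdev_pull_lt inAk_pull_of_regPr embIter_eq_transl)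
open Summit.QuantumFields.YangMills.Theorems.Prop7SPrintThm2Dict (mulCfg_pull)
open Summit.QuantumFields.YangMills.Theorems.Prop7ChartSigmaT3GlevSU (pull_eq_expCfg_of_exp)

variable {F : T3Family} {n K : ℕ}

/-! ## §1 Two pullback letters -/

/-- `(U^u)♯ = mgauge U₀♯ up U₁♯ · U₀♯` for `U = (U₁U₀)^u` — the based pullback of `gaugeAct u (emb15 U₀ U₁)` in the letters of lit `B8Eq106Local` ((1.17) = (55) of [3]).
[cite: Balaban1985RegularSpaces, (1.16)-(1.17) p.78; Balaban1985Averaging, (55) p.27] -/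
theorem pull_gaugeAct_emb15_eq (U₀ U₁ : GaugeField (F.P K) 0 (Matrix.specialUnitaryGroup (Fin 2) ℂ)) (u : GaugeTransf (F.P K) 0 (Matrix.specialUnitaryGroup (Fin 2) ℂ))
    (x₀ : Site (F.P K) 0) :
    pull (unitsField (toUField (GaugeField.gaugeAct u (emb15 U₀ U₁)))) x₀ =
      mgauge (pull (unitsField (toUField U₀)) x₀) (pullGauge (fun x => Unitary.toUnits (toUGauge (F.P K) 2 u x)) x₀) (pull (unitsField (toUField U₁)) x₀)
        * pull (unitsField (toUField U₀)) x₀ := by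
  rw [← eq117_eq_mgauge, mulCfg_pull, ← pull_toUField_gaugeAct]
  funext z μ
  simp only [Pi.mul_apply, B8Lemma1NonAbelian.pert, inv_mul_cancel_right]
  rfl

/-! ## §2 (1.72) at the k-centres -/

/-- ★★ **[Balaban1985RegularSpaces] (1.72) AT THE k-CENTRES OF THE T³ CARRIER.**  Member `F`, heights `n ≤ K`, `k = K − n`, `η = L^{−k}`; background `W` with print's regularity (2) at radius `ε`
(`RegPr F n K ε W`); a gauge transformation `u` with the based restriction (1.29) (`RestrictedPrint F n K W u`) bringing `U₁W` to the based axial gauge (1.19) relative to `W`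
(`IsAxialPrint F n K W (gaugeAct u (emb15 W U₁))`) — COV's conclusion letters; `U₁ = e^{iX}` bondwise with `‖X b‖ ≤ c·η`.  Under print's numeric windows (displayed, L-only) the value of `u`
at every k-centre is `120c`-close to `1`: `dist1 (u (embIter k y)) ≤ 40·3·c`.
[cite: Balaban1985RegularSpaces, (1.70)-(1.72) p.88, (1.19) p.79, (1.29) p.81; Balaban1985Averaging, (104)-(106) p.33, Prop. 2 p.26; Balaban1985Variational, Prop. 2 p.281] -/
theorem dist1_centre_le_of_axial_restricted (F : T3Family) {n K : ℕ} (h : n ≤ K) {ε c : ℝ} (hε : 0 < ε) (hc : 0 ≤ c)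
    (W : GaugeField (F.P K) 0 (Matrix.specialUnitaryGroup (Fin 2) ℂ)) (hreg : RegPr F n K ε W)
    (u : GaugeTransf (F.P K) 0 (Matrix.specialUnitaryGroup (Fin 2) ℂ)) (U₁ : GaugeField (F.P K) 0 (Matrix.specialUnitaryGroup (Fin 2) ℂ))
    (X : PBond (F.P K) 0 → Matrix (Fin 2) (Fin 2) ℂ)
    (hax : IsAxialPrint F n K W (GaugeField.gaugeAct u (emb15 W U₁))) (h129 : RestrictedPrint F n K W u)
    (hexp : ∀ b : PBond (F.P K) 0, ((U₁ b : Matrix.specialUnitaryGroup (Fin 2) ℂ) : Matrix (Fin 2) (Fin 2) ℂ) = exp (Complex.I • X b))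
    (hXc : ∀ b : PBond (F.P K) 0, ‖X b‖ ≤ c * eta F n K)
    -- print's numeric windows ([Balaban1985Averaging] Prop. 2; [Balaban1985RegularSpaces] p. 88), L-only
    (hα3 : C0 3 * (2 * ε) ≤ 1 / 3) (hα4 : 4 * (2 * ε) ≤ c2' 3 F.L)
    (hsmall : Real.exp (4 * (800 * ((3 : ℝ) + 1) ^ 2 * ((3 : ℝ) + 4)) * (2 * ε)) * (1 + 8 * (131072 * ((3 : ℝ) + 1) ^ 2) * c) ≤ 2)
    (hc₃ : 2 * c ≤ c3 3 F.L) (hs : 128 * (3 : ℝ) * c ≤ 1)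
    (y : Site (F.P K) (K - n)) :
    dist1 (u (embIter (K - n) y)) ≤ 40 * 3 * c := by
  letI : CStarAlgebra (Matrix (Fin 2) (Fin 2) ℂ) := B10Eq29TubeLine.cstarAlgebraMatrix 2
  -- letters
  set x₀ : Site (F.P K) 0 := basePt F n K with hx₀
  set Wp : LSite (F.P K).d → Fin (F.P K).d → (Matrix (Fin 2) (Fin 2) ℂ)ˣ := pull (unitsField (toUField W)) x₀ with hWp
  set up : LSite (F.P K).d → (Matrix (Fin 2) (Fin 2) ℂ)ˣ := pullGauge (fun x => Unitary.toUnits (toUGauge (F.P K) 2 u x)) x₀ with hup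
  set B : LSite (F.P K).d → Fin (F.P K).d → Matrix (Fin 2) (Fin 2) ℂ := fun z κ => Complex.I • X ⟨transl x₀ z, κ⟩ with hB
  set yz : LSite (F.P K).d := fun μ => ((y μ).val : ℤ) with hyz
  have hd : (F.P K).d = 3 := rfl
  have hLF : (F.P K).L = F.L := rfl
  have hL2 : 2 ≤ (F.P K).L := (F.P K).hL.2
  have hL1 : 1 ≤ (F.P K).L := le_trans (by norm_num) hL2
  have hk : K - n ≤ (F.P K).m + (F.P K).K := by show K - n ≤ F.m + K; omega
  -- the group and the valuedness
  have hG : AvgClosed (F.P K).d (F.P K).L (specialUnitaryUnits (Fin 2)) := avgClosed_specialUnitary_of_le_twentyone (by norm_num) _ _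
  have hmem : ∀ z κ, Wp z κ ∈ specialUnitaryUnits (Fin 2) := pull_toUField_mem W x₀
  have hU1 : ∀ z κ, Wp z κ ∈ B7Prop1Explicit.U1 (Matrix (Fin 2) (Fin 2) ℂ) := fun z κ => unitaryUnits_le_U1 (specialUnitaryUnits_le_unitaryUnits (hmem z κ))
  -- (1.33) on the block under `yz` from `RegPr e W`
  have h2e : 0 < 2 * ε := by positivity
  have h33 : pdevOn (tlo (F.P K).L yz (K - n)) (thi (F.P K).L yz (K - n)) Wp < 2 * ε * ((((F.P K).L : ℝ) ^ (K - n))⁻¹) ^ 2 :=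
    (pdevOn_le_pdev hU1).trans_lt (pdev_pull_lt hε (inAk_pull_of_regPr F hε.le hreg) x₀)
  -- (1.69): `|B_b| ≤ c·L^{−(K - n)}`
  have hη : eta F n K = (((F.P K).L : ℝ) ^ (K - n))⁻¹ := by
    show ((F.L : ℝ)⁻¹) ^ (K - n) = _
    rw [inv_pow]; rfl
  have h69 : ∀ (x : LSite (F.P K).d) (κ : Fin (F.P K).d), B7Prop1Local.InBox (tlo (F.P K).L yz (K - n)) (thi (F.P K).L yz (K - n)) x →
      B7Prop1Local.InBox (tlo (F.P K).L yz (K - n)) (thi (F.P K).L yz (K - n)) (x + B7Prop1Explicit.e κ) → ‖B x κ‖ ≤ c * (((F.P K).L : ℝ) ^ (K - n))⁻¹ := by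
    intro x κ _ _
    rw [hB]
    simp only [norm_smul, Complex.norm_I, one_mul]
    rw [← hη]; exact hXc _
  -- (1.19) in the tower and (1.29) at `yz`, from the based classes
  have hUp : pull (unitsField (toUField (GaugeField.gaugeAct u (emb15 W U₁)))) x₀ = mgauge Wp up (expCfg B) * Wp := by
    rw [pull_gaugeAct_emb15_eq, pull_eq_expCfg_of_exp F U₁ X hexp x₀]
  have hAx : InAx (F.P K).L (K - n) (torusLam (K - n)) Wp (mgauge Wp up (expCfg B) * Wp) := by
    have h0 : InAx (F.P K).L (K - n) (torusLam (K - n)) Wp (pull (unitsField (toUField (GaugeField.gaugeAct u (emb15 W U₁)))) x₀) := hax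
    rwa [hUp] at h0
  have hyzΛ : yz ∈ torusLam (d := (F.P K).d) (K - n) (K - n) := (mem_torusLam_iff (K - n) (K - n) yz).2 rfl
  have hax' : ∀ m, m < (K - n) → ∀ z : LSite (F.P K).d, Under (F.P K).L ((K - n) - (m + 1)) yz z → ∀ r : Fin (F.P K).d → Fin (F.P K).L,
      B7Eq92Concrete.tHol (B7Prop2Explicit.avgIter (F.P K).L Wp m) (B7Eq92Concrete.tildIter (F.P K).L Wp (mgauge Wp up (expCfg B)) m)
        (((F.P K).L : ℤ) • z) (B7Prop1Explicit.treeWord (B7Prop1Explicit.boxVec (F.P K).L r)) = 1 :=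
    fun m hm z hz r => (ax119_iff_ax67 (F.P K).L Wp (mgauge Wp up (expCfg B)) m z r).1 (hAx (K - n) (by omega) le_rfl yz hyzΛ m hm z hz r)
  have h129' : B7Eq84Concrete.uavg (F.P K).L Wp up (K - n) yz = 1 := (restr129_iff_uavg _ _ _ _ _).1 h129 (K - n) le_rfl yz hyzΛ
  -- the windows in the lemma's letters (`d = 3`)
  have hd3 : (((F.P K).d : ℕ) : ℝ) = 3 := by rw [hd]; norm_num
  have hsmall' : Real.exp (4 * (800 * ((((F.P K).d : ℕ) : ℝ) + 1) ^ 2 * ((((F.P K).d : ℕ) : ℝ) + 4)) * (2 * ε))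
      * (1 + 8 * (131072 * ((((F.P K).d : ℕ) : ℝ) + 1) ^ 2) * c) ≤ 2 := by rw [hd3]; exact hsmall
  have hs' : 128 * (((F.P K).d : ℕ) : ℝ) * c ≤ 1 := by rw [hd3]; exact hs
  -- (1.72) on the block under `yz`, at its corner `Lᵏyz` = the (K - n)-centre `embIter (K - n) y`
  have key := ineq172_local_of_axial (u₁ := up) hL2 hG hmem h2e hα3 hα4 h33 hc h69 hsmall' hc₃ hs' hL1 hax' h129'
    ((((F.P K).L : ℤ) ^ (K - n)) • yz) (under_smul_self hL1 (K - n) yz)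
  have hcentre : transl x₀ ((((F.P K).L : ℤ) ^ (K - n)) • yz) = embIter (K - n) y := by
    rw [hx₀, embIter_eq_transl hk y]; rfl
  have hval : ((up ((((F.P K).L : ℤ) ^ (K - n)) • yz) : (Matrix (Fin 2) (Fin 2) ℂ)ˣ) : Matrix (Fin 2) (Fin 2) ℂ)
      = ((u (embIter (K - n) y) : Matrix.specialUnitaryGroup (Fin 2) ℂ) : Matrix (Fin 2) (Fin 2) ℂ) := by
    rw [hup, pullGauge_apply, hcentre, Unitary.val_toUnits_apply, toUGauge_apply, val_suIncl]
  have hdist : dist1 (u (embIter (K - n) y)) = ‖((u (embIter (K - n) y) : Matrix.specialUnitaryGroup (Fin 2) ℂ) : Matrix (Fin 2) (Fin 2) ℂ) - 1‖ := rfl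
  rw [hdist, ← hval]
  calc ‖((up ((((F.P K).L : ℤ) ^ (K - n)) • yz) : (Matrix (Fin 2) (Fin 2) ℂ)ˣ) : Matrix (Fin 2) (Fin 2) ℂ) - 1‖ ≤ 40 * ((F.P K).d : ℝ) * c := key
    _ = 40 * 3 * c := by rw [hd3]

end Summit.QuantumFields.YangMills.Theorems.Prop7Thm2GaugeCentreValues

end
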